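import Mathlib
import HarnessLib
import Summits.HubbardSuperconductivity.HubbardSuperconductivity.Theorems.KLProgrammeH10TwoPointLimitPerturbedFermiRadius
import Summits.HubbardSuperconductivity.HubbardSuperconductivity.Theorems.KLProgrammeH10TwoPointLimitPerturbedCountCalculus

/-!
# Route `KLProgramme` — crux K1 `H10TwoPointLimit` (stmt-HubbardSuperconductivity-19938):
# symmetries of the perturbed Fermi curve as a FUNCTION of the angle, and the anti-diagonal of the perturbed count

The free toolbox uses everywhere that the band curve is `2π`-periodic and centrally symmetric as a parametrised curve
(`band_add_int_mul_two_pi`, `band_add_pi`: `p(θ + π) = -p(θ)`, `p'(θ + π) = -p'(θ)`), in particular on the anti-diagonal of the count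
(`hfun_add_pi`: `h(θ₂, θ₂ + π) = 0`, the Cooper configuration). For a root SELECTION `u` of the perturbed curve `{ε₀ + δ = μ}` these are not
automatic (two rays may carry different selections) — they follow from ray-wise UNIQUENESS (`shifted_unique`, radial Lipschitz `κ₁ < Dt_min`) and
the symmetry of the root SET (`isBandFermiRadius_shifted_add_two_pi`, and `…_add_pi` for EVEN `δ`):

* `root_add_two_pi`, `root_add_pi` (even `δ`): `u(θ + 2π) = u(θ)`, `u(θ + π) = u(θ)`; hence `deriv u` has the same symmetries
  (`deriv_root_add_two_pi`, `deriv_root_add_pi`);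
* the curve and its velocity: `XE/YE u (θ + π) = -XE/YE u θ`, `VXE/VYE u (θ + π) = -VXE/VYE u θ` (`curve_add_pi`, `velocity_add_pi`), and
  `2π`-periodicity (`curve_add_two_pi`, `velocity_add_two_pi`);
* the anti-diagonal of the perturbed offset count: `momE u P θ (θ + π) = (P₁, P₂)` and
  `hfunE δ u μ P θ (θ + π) = ε₀(P) + δ(P) - μ` — constant in `θ` (`momE_antiDiagonal`, `hfunE_antiDiagonal`; the tree's `hfun_add_pi` is the case
  `P = p(θ₁)` on the curve, value `0`).

Hypotheses: `B : BandBounds a b`, `|δ| ≤ κ₀` and `‖Dδ‖ ≤ κ₁ < Dt_min` on the closed square (differentiability there), `[μ - κ₀, μ + κ₀] ⊂ [a, b]`,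
`u` any root selection. Everything is PROVED; no definitions. References: BGM 2006 App. A2 (the Cooper configuration `θ₃ = θ₂ + π`)
[cite: BenfattoGiulianiMastropietro2006]; HOME/prover-p4/PORT-NOTE.md (β).
-/

noncomputable section

namespace Summit.HubbardSuperconductivity.HubbardSuperconductivity.Theorems.PerturbedFermiCurve

set_option linter.dupNamespace false -- summit = problem name (single-conjunct summit), D-0017

open Real Set
open Literature.MathematicalPhysics.QuantumLattice Literature.MathematicalPhysics.QuantumLattice.BandSectorCounting

section Symmetry

variable {a b : ℝ} (B : BandBounds a b) {δ : (Fin 2 → ℝ) → ℝ} {κ₀ κ₁ μ : ℝ}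
  (hδ : ∀ k : Fin 2 → ℝ, (∀ i, |k i| ≤ π) → |δ k| ≤ κ₀) (hlo : a ≤ μ - κ₀) (hhi : μ + κ₀ ≤ b)
  (hd : ∀ k : Fin 2 → ℝ, (∀ i, |k i| ≤ π) → DifferentiableAt ℝ δ k)
  (hκ : ∀ k : Fin 2 → ℝ, (∀ i, |k i| ≤ π) → ‖fderiv ℝ δ k‖ ≤ κ₁) (hκ₁ : κ₁ < B.Dtmin)
  {u : ℝ → ℝ} (hu : ∀ θ, IsBandFermiRadius (μ - δ (u θ • dir θ)) θ (u θ))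
include B hδ hlo hhi hd hκ hκ₁ hu

/-- **`2π`-periodicity of a root selection**: `u(θ + 2π) = u(θ)` (same ray, uniqueness). [folklore] -/
theorem root_add_two_pi (θ : ℝ) : u (θ + 2 * π) = u θ := by
  have h1 : IsBandFermiRadius (μ - δ (u (θ + 2 * π) • dir θ)) θ (u (θ + 2 * π)) :=
    (isBandFermiRadius_shifted_add_two_pi δ μ θ (u (θ + 2 * π))).1 (hu (θ + 2 * π))
  exact shifted_unique B hδ hlo hhi (radialLipschitz_of_fderiv_le hd hκ θ) hκ₁ h1 (hu θ)

/-- **Central symmetry of a root selection for an EVEN perturbation**: `u(θ + π) = u(θ)`. [folklore] -/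
theorem root_add_pi (heven : ∀ k, δ (-k) = δ k) (θ : ℝ) : u (θ + π) = u θ := by
  have h1 : IsBandFermiRadius (μ - δ (u (θ + π) • dir θ)) θ (u (θ + π)) :=
    (isBandFermiRadius_shifted_add_pi heven μ θ (u (θ + π))).1 (hu (θ + π))
  exact shifted_unique B hδ hlo hhi (radialLipschitz_of_fderiv_le hd hκ θ) hκ₁ h1 (hu θ)

/-- `u ∘ (· + 2π) = u` as functions. [folklore] -/
theorem root_comp_add_two_pi : (fun θ => u (θ + 2 * π)) = u := funext (root_add_two_pi B hδ hlo hhi hd hκ hκ₁ hu)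

/-- `u ∘ (· + π) = u` as functions (even `δ`). [folklore] -/
theorem root_comp_add_pi (heven : ∀ k, δ (-k) = δ k) : (fun θ => u (θ + π)) = u :=
  funext (root_add_pi B hδ hlo hhi hd hκ hκ₁ hu heven)

/-- `u'(θ + 2π) = u'(θ)`. [folklore] -/
theorem deriv_root_add_two_pi (θ : ℝ) : deriv u (θ + 2 * π) = deriv u θ := by
  have h := congrArg (fun f => deriv f θ) (root_comp_add_two_pi B hδ hlo hhi hd hκ hκ₁ hu)
  simp only [deriv_comp_add_const] at h
  exact h

/-- `u'(θ + π) = u'(θ)` (even `δ`). [folklore] -/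
theorem deriv_root_add_pi (heven : ∀ k, δ (-k) = δ k) (θ : ℝ) : deriv u (θ + π) = deriv u θ := by
  have h := congrArg (fun f => deriv f θ) (root_comp_add_pi B hδ hlo hhi hd hκ hκ₁ hu heven)
  simp only [deriv_comp_add_const] at h
  exact h

/-- **`2π`-periodicity of the perturbed curve and its velocity.** [folklore] -/
theorem curve_add_two_pi (θ : ℝ) :
    XE u (θ + 2 * π) = XE u θ ∧ YE u (θ + 2 * π) = YE u θ ∧
      VXE u (θ + 2 * π) = VXE u θ ∧ VYE u (θ + 2 * π) = VYE u θ := by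
  simp only [XE, YE, VXE, VYE, root_add_two_pi B hδ hlo hhi hd hκ hκ₁ hu, deriv_root_add_two_pi B hδ hlo hhi hd hκ hκ₁ hu,
    Real.cos_add_two_pi, Real.sin_add_two_pi]
  exact ⟨trivial, trivial, trivial, trivial⟩

/-- **Central symmetry of the perturbed curve (even `δ`)**: `p_E(θ + π) = -p_E(θ)` and `p_E'(θ + π) = -p_E'(θ)` (the tree's `band_add_pi`
on the moving curve). [cite: BenfattoGiulianiMastropietro2006, §2.4 Lemma 2.1] -/
theorem curve_add_pi (heven : ∀ k, δ (-k) = δ k) (θ : ℝ) :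
    XE u (θ + π) = -XE u θ ∧ YE u (θ + π) = -YE u θ ∧ VXE u (θ + π) = -VXE u θ ∧ VYE u (θ + π) = -VYE u θ := by
  simp only [XE, YE, VXE, VYE, root_add_pi B hδ hlo hhi hd hκ hκ₁ hu heven, deriv_root_add_pi B hδ hlo hhi hd hκ hκ₁ hu heven,
    Real.cos_add_pi, Real.sin_add_pi]
  refine ⟨?_, ?_, ?_, ?_⟩ <;> ring

/-- Periodicity under integer multiples of `2π` of a root selection. [folklore] -/
theorem root_add_int_mul_two_pi (θ : ℝ) (m : ℤ) : u (θ + m * (2 * π)) = u θ := by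
  induction m using Int.induction_on generalizing θ with
  | zero => simp
  | succ n ih =>
    have e : θ + (((n : ℤ) + 1 : ℤ) : ℝ) * (2 * π) = (θ + ((n : ℤ) : ℝ) * (2 * π)) + 2 * π := by push_cast; ring
    rw [e, root_add_two_pi B hδ hlo hhi hd hκ hκ₁ hu]
    exact ih θ
  | pred n ih =>
    have h := root_add_two_pi B hδ hlo hhi hd hκ hκ₁ hu (θ + ((-(n : ℤ) - 1 : ℤ) : ℝ) * (2 * π))
    have e : θ + ((-(n : ℤ) - 1 : ℤ) : ℝ) * (2 * π) + 2 * π = θ + ((-(n : ℤ) : ℤ) : ℝ) * (2 * π) := by push_cast; ring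
    rw [e] at h
    exact h.symm.trans (ih θ)

/-! ### The anti-diagonal (Cooper configuration) of the perturbed offset count -/

/-- **On the anti-diagonal the momentum sum is the offset**: `P + p_E(θ) + p_E(θ + π) = P` (even `δ`). [folklore] -/
theorem momE_antiDiagonal (heven : ∀ k, δ (-k) = δ k) (P : ℝ × ℝ) (θ : ℝ) :
    momE u P θ (θ + π) = ![P.1, P.2] := by
  obtain ⟨hx, hy, -, -⟩ := curve_add_pi B hδ hlo hhi hd hκ hκ₁ hu heven θ
  ext i; fin_cases i
  · simp [momE, SXE, hx]
  · simp [momE, SYE, hy]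

/-- **The perturbed level function is constant on the anti-diagonal**: `h^E_P(θ, θ + π) = ε₀(P) + δ(P) - μ` (even `δ`); for `P` on the
perturbed curve this is `0` — the Cooper configuration (the tree's `hfun_add_pi`). [cite: BenfattoGiulianiMastropietro2006, App. A2] -/
theorem hfunE_antiDiagonal (heven : ∀ k, δ (-k) = δ k) (P : ℝ × ℝ) (θ : ℝ) :
    hfunE δ u μ P θ (θ + π) = sqDispersion ![P.1, P.2] + δ ![P.1, P.2] - μ := by
  rw [hfunE_eq_sqDispersion, momE_antiDiagonal B hδ hlo hhi hd hκ hκ₁ hu heven]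

/-- In particular `∂_θ h^E_P(θ, θ + π)`-type differences vanish: `h^E_P(θ, θ + π) = h^E_P(θ', θ' + π)`. [folklore] -/
theorem hfunE_antiDiagonal_const (heven : ∀ k, δ (-k) = δ k) (P : ℝ × ℝ) (θ θ' : ℝ) :
    hfunE δ u μ P θ (θ + π) = hfunE δ u μ P θ' (θ' + π) := by
  rw [hfunE_antiDiagonal B hδ hlo hhi hd hκ hκ₁ hu heven, hfunE_antiDiagonal B hδ hlo hhi hd hκ hκ₁ hu heven]

end Symmetry

end Summit.HubbardSuperconductivity.HubbardSuperconductivity.Theorems.PerturbedFermiCurve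

end
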